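import Mathlib

/-!
# `SnSubsetDichotomy.ThresholdSubsetTriples`, line `SketchIdeator6` (genus / Riemann–Hurwitz certificate) — stub `stub_rhOrbitSwap`

Registered stub `stub_rhOrbitSwap` of the lead skeleton (crux `stmt-MatrixMultiplication-10882`).
Adjoining a transposition to a permutation group merges the two orbits of its endpoints and changes nothing else.
-/

namespace Summit.MatrixMultiplication.MatrixMultiplication.Theorems.ThresholdSubsetTriples

/-- Translating a point by a group element does not change the orbit it lies in. -/
private theorem rh_smul_mem_orbit_iff {G β : Type*} [Group G] [MulAction G β] (g : G)
    (x z : β) : g • x ∈ MulAction.orbit G z ↔ x ∈ MulAction.orbit G z := by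
  rw [← MulAction.orbit_eq_iff, MulAction.orbit_smul, MulAction.orbit_eq_iff]

/-- Orbits are monotone in the acting subgroup. -/
private theorem rh_orbit_mono {G β : Type*} [Group G] [MulAction G β] {H K : Subgroup G}
    (hHK : H ≤ K) {x y : β} (h : x ∈ MulAction.orbit H y) : x ∈ MulAction.orbit K y := by
  obtain ⟨k, hk⟩ := MulAction.mem_orbit_iff.mp h
  exact MulAction.mem_orbit_iff.mpr ⟨⟨k.1, hHK k.2⟩, hk⟩

open scoped Pointwise in
/-- The orbit relation of `H ⊔ ⟨swap a b⟩`: the `H`-orbits of `a` and `b` are merged and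
nothing else changes. -/
private theorem rh_mem_orbit_sup_swap_iff {α : Type*} [DecidableEq α]
    (H : Subgroup (Equiv.Perm α)) (a b x y : α) :
    x ∈ MulAction.orbit (H ⊔ Subgroup.zpowers (Equiv.swap a b) : Subgroup (Equiv.Perm α)) y ↔
      (x ∈ MulAction.orbit H y ∨ (x ∈ MulAction.orbit H a ∧ y ∈ MulAction.orbit H b) ∨
        (x ∈ MulAction.orbit H b ∧ y ∈ MulAction.orbit H a)) := by
  set K : Subgroup (Equiv.Perm α) := H ⊔ Subgroup.zpowers (Equiv.swap a b)
  have hHK : H ≤ K := le_sup_left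
  have hsK : Equiv.swap a b ∈ K := Subgroup.mem_sup_right (Subgroup.mem_zpowers _)
  have hab : MulAction.orbit K a = MulAction.orbit K b := by
    have h : (⟨Equiv.swap a b, hsK⟩ : K) • b = a := by
      show Equiv.swap a b b = a
      exact Equiv.swap_apply_right a b
    rw [← h, MulAction.orbit_smul]
  constructor
  · intro hx
    obtain ⟨k, rfl⟩ := MulAction.mem_orbit_iff.mp hx
    -- the set of points related to `y` is stable under every generator of `K`, hence under `K`
    set S : Set α := {z | z ∈ MulAction.orbit H y ∨
      (z ∈ MulAction.orbit H a ∧ y ∈ MulAction.orbit H b) ∨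
        (z ∈ MulAction.orbit H b ∧ y ∈ MulAction.orbit H a)} with hS
    have hKS : K ≤ MulAction.stabilizer (Equiv.Perm α) S := by
      refine sup_le ?_ ?_
      · intro h hh
        rw [MulAction.mem_stabilizer_set]
        intro z
        have e : ∀ w : α, h • z ∈ MulAction.orbit H w ↔ z ∈ MulAction.orbit H w :=
          fun w => rh_smul_mem_orbit_iff (⟨h, hh⟩ : H) z w
        simp only [hS, Set.mem_setOf_eq, e]
      · rw [Subgroup.zpowers_le, MulAction.mem_stabilizer_set]
        intro z
        have ha : a ∈ MulAction.orbit H a := MulAction.mem_orbit_self a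
        have hb : b ∈ MulAction.orbit H b := MulAction.mem_orbit_self b
        have hay : a ∈ MulAction.orbit H y ↔ y ∈ MulAction.orbit H a :=
          MulAction.mem_orbit_symm
        have hby : b ∈ MulAction.orbit H y ↔ y ∈ MulAction.orbit H b :=
          MulAction.mem_orbit_symm
        simp only [hS, Set.mem_setOf_eq, Equiv.Perm.smul_def]
        by_cases hza : z = a
        · subst hza
          rw [Equiv.swap_apply_left]
          tauto
        · by_cases hzb : z = b
          · subst hzb
            rw [Equiv.swap_apply_right]
            tauto
          · rw [Equiv.swap_apply_of_ne_of_ne hza hzb]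
    have hk : (k : Equiv.Perm α) • y ∈ S ↔ y ∈ S :=
      (MulAction.mem_stabilizer_set.mp (hKS k.2)) y
    have hy : y ∈ S := Or.inl (MulAction.mem_orbit_self y)
    exact hk.mpr hy
  · rintro (h | ⟨h1, h2⟩ | ⟨h1, h2⟩)
    · exact rh_orbit_mono hHK h
    · have h1' := MulAction.orbit_eq_iff.mpr (rh_orbit_mono hHK h1)
      have h2' := MulAction.orbit_eq_iff.mpr (rh_orbit_mono hHK h2)
      rw [← MulAction.orbit_eq_iff, h1', hab, h2']
    · have h1' := MulAction.orbit_eq_iff.mpr (rh_orbit_mono hHK h1)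
      have h2' := MulAction.orbit_eq_iff.mpr (rh_orbit_mono hHK h2)
      rw [← MulAction.orbit_eq_iff, h1', ← hab, h2']

/-- **Stub `stub_rhOrbitSwap`.** Orbits of `H ⊔ ⟨(a b)⟩`: explicit orbit relation and orbit count. [folklore] -/
theorem stub_rhOrbitSwap : ∀ (α : Type) [Fintype α] [DecidableEq α] (H : Subgroup (Equiv.Perm α)) (a b : α), (∀ x y : α, x ∈ MulAction.orbit (H ⊔ Subgroup.zpowers (Equiv.swap a b) : Subgroup (Equiv.Perm α)) y ↔ (x ∈ MulAction.orbit H y ∨ (x ∈ MulAction.orbit H a ∧ y ∈ MulAction.orbit H b) ∨ (x ∈ MulAction.orbit H b ∧ y ∈ MulAction.orbit H a))) ∧ (a ∈ MulAction.orbit H b → Nat.card (MulAction.orbitRel.Quotient ((H ⊔ Subgroup.zpowers (Equiv.swap a b) : Subgroup (Equiv.Perm α))) (α)) = Nat.card (MulAction.orbitRel.Quotient (H) (α))) ∧ (a ∉ MulAction.orbit H b → Nat.card (MulAction.orbitRel.Quotient ((H ⊔ Subgroup.zpowers (Equiv.swap a b) : Subgroup (Equiv.Perm α))) (α)) + 1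 = Nat.card (MulAction.orbitRel.Quotient (H) (α))) := by
  intro α _ _ H a b
  set K : Subgroup (Equiv.Perm α) := H ⊔ Subgroup.zpowers (Equiv.swap a b)
  have hHK : H ≤ K := le_sup_left
  have key : ∀ x y : α, x ∈ MulAction.orbit K y ↔
      (x ∈ MulAction.orbit H y ∨ (x ∈ MulAction.orbit H a ∧ y ∈ MulAction.orbit H b) ∨
        (x ∈ MulAction.orbit H b ∧ y ∈ MulAction.orbit H a)) :=
    fun x y => rh_mem_orbit_sup_swap_iff H a b x y
  refine ⟨key, fun hab => ?_, fun hab => ?_⟩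
  · -- `a` and `b` already share an `H`-orbit: the two orbit relations coincide
    refine Nat.card_congr (Quotient.congrRight fun x y => ?_)
    show x ∈ MulAction.orbit K y ↔ x ∈ MulAction.orbit H y
    rw [key]
    refine ⟨?_, Or.inl⟩
    rintro (h | ⟨h1, h2⟩ | ⟨h1, h2⟩)
    · exact h
    · rw [← MulAction.orbit_eq_iff] at h1 h2 hab ⊢
      rw [h1, hab, h2]
    · rw [← MulAction.orbit_eq_iff] at h1 h2 hab ⊢
      rw [h1, ← hab, h2]
  · -- otherwise the `H`-orbits of `a` and `b` merge: count via the induced map on quotients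
    classical
    let RH : Setoid α := MulAction.orbitRel H α
    let RK : Setoid α := MulAction.orbitRel K α
    let qb : MulAction.orbitRel.Quotient H α := Quotient.mk RH b
    let φ : MulAction.orbitRel.Quotient H α → MulAction.orbitRel.Quotient K α :=
      Quotient.lift (fun x => Quotient.mk RK x) (fun x y h => Quotient.sound (rh_orbit_mono hHK h))
    have hφmk : ∀ x : α, φ (Quotient.mk RH x) = Quotient.mk RK x := fun x => rfl
    have hφeq : ∀ x y : α, φ (Quotient.mk RH x) = φ (Quotient.mk RH y) ↔
        (x ∈ MulAction.orbit H y ∨ (x ∈ MulAction.orbit H a ∧ y ∈ MulAction.orbit H b) ∨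
          (x ∈ MulAction.orbit H b ∧ y ∈ MulAction.orbit H a)) := by
      intro x y
      rw [hφmk, hφmk, ← key]
      exact ⟨fun h => Quotient.exact h, fun h => Quotient.sound h⟩
    have hinj : ∀ x y : α, Quotient.mk RH x ≠ qb → Quotient.mk RH y ≠ qb →
        φ (Quotient.mk RH x) = φ (Quotient.mk RH y) → Quotient.mk RH x = Quotient.mk RH y := by
      intro x y hx hy h
      rcases (hφeq x y).mp h with hxy | ⟨-, h2⟩ | ⟨h1, -⟩
      · exact Quotient.sound hxy
      · exact absurd (Quotient.sound h2) hy
      · exact absurd (Quotient.sound h1) hx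
    let T := {q : MulAction.orbitRel.Quotient H α // q ≠ qb}
    let ψ : T → MulAction.orbitRel.Quotient K α := fun q => φ q.1
    have hψ : Function.Bijective ψ := by
      constructor
      · rintro ⟨q₁, h₁⟩ ⟨q₂, h₂⟩ h
        induction q₁ using Quotient.inductionOn
        induction q₂ using Quotient.inductionOn
        exact Subtype.ext (hinj _ _ h₁ h₂ h)
      · intro q
        induction q using Quotient.inductionOn
        rename_i x
        by_cases hx : Quotient.mk RH x = qb
        · refine ⟨⟨Quotient.mk RH a, fun h => hab (Quotient.exact h)⟩, ?_⟩
          show φ (Quotient.mk RH a) = φ (Quotient.mk RH x)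
          rw [hφeq]
          exact Or.inr (Or.inl ⟨MulAction.mem_orbit_self a, Quotient.exact hx⟩)
        · exact ⟨⟨Quotient.mk RH x, hx⟩, rfl⟩
    have h1 : Nat.card T = Nat.card (MulAction.orbitRel.Quotient K α) :=
      Nat.card_eq_of_bijective ψ hψ
    have h2 : Nat.card (MulAction.orbitRel.Quotient H α) = Nat.card T + 1 := by
      rw [← Finite.card_option]
      exact (Nat.card_congr (Equiv.optionSubtypeNe qb)).symm
    omega

end Summit.MatrixMultiplication.MatrixMultiplication.Theorems.ThresholdSubsetTriples
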